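import Summits.QuantumAdvantage.QuantumAdvantage.Theorems.WbwObfuscatedGluedTreesKowGenVocabulary

/-!
# Stub `stub_admissible` — admissibility of the line datum of the landed generator
# (crux `WbwObfuscatedGluedTrees`, stmt-QuantumAdvantage-2340; line `knowledge-of-walk-split`, stage 2)

The registered stub `stub_admissible` of the stage-2 skeleton (target
`Cruxes.WbwObfuscatedGluedTrees.KnowledgeOfWalkSplit.Generator.GeneratorTransfer`), EXACT registered signature:
the seven clauses of `KnowledgeOfWalkSplit.LineData.Admissible` for the line datum `D.lineData Γ₁ P` of the
master data `D` (vocabulary `WbwObfuscatedGluedTreesKowGenVocabulary`) follow from the definitional side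
conditions `GenAdmissible D O P` (shipped presentation) and `RefAdmissible D Γ₁ O` (reference presentation).

Proof (bookkeeping, no hardness content).  Clauses (1)–(4) are clauses (1)–(4) of `GenAdmissible`.  Since
`4 t n ≤ n`, the key `k = s.take (4 t |s|)` has length `4 t |s|`, so the level read off the key is
`|k| / 4 = t |s|`; rewriting it, clause (6) is `GenAdmissible` (6) with `RefAdmissible` (2), and clause (7)
is `GenAdmissible` (8) with `RefAdmissible` (3) (threshold `max n₀ n₁`).  Clause (5): by `length_boolPair`
and `length_vname` the three lengths are `2·|code C₀ k| + 2 + N`, `2·|code C₁ k| + 2 + N` and `N`, where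
`N = Nℓ (t n) ≤ ς (t n) ≤ p(n)` (`ppolyCircuits` membership and `GenAdmissible` (3)) and
`|code Cᵢ k| ≤ qᵢ (t n + 4 t n) ≤ qᵢ (n + n)` (the code-length clauses and monotonicity of `ℕ`-polynomial
evaluation, `natPoly_eval_mono` of `Complexity/CircuitLowerBounds`); the bound is the polynomial
`2 q₀(2X) + 2 q₁(2X) + 3 p + 4` (`GenAdm.eval_lenPoly`). [folklore]
-/

set_option linter.dupNamespace false

namespace Summit.QuantumAdvantage.QuantumAdvantage.Theorems.WbwObfuscatedGluedTrees.KnowledgeOfWalk.Generator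

open Literature.Computability.Cryptography Literature.Computability.Complexity Filter Asymptotics
open Literature.Computability.Cryptography.ObfuscatedGluedTrees
open Literature.Computability.QuantumComplexity
open Summit.QuantumAdvantage.QuantumAdvantage.Theorems.WbwObfuscatedGluedTrees.Negative (ClauseC)
open Summit.QuantumAdvantage.QuantumAdvantage.Theorems.WbwObfuscatedGluedTrees.KnowledgeOfWalk
  (WalkModel inst KnowledgeOfWalk WordHard Coherent genObf genClear keyed)
open Summit.QuantumAdvantage.QuantumAdvantage.Cruxes.WbwObfuscatedGluedTrees.KnowledgeOfWalkSplit (LineData)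
open Polynomial

/-! ## Bookkeeping lemmas (sub-namespace `GenAdm`) -/

namespace GenAdm

/-- `|name_K(ENTRANCE)| = N ℓ` at master parameter `ℓ`. [folklore] -/
theorem length_entranceNameℓ (D : MasterData) (P : PuncturablePRFScheme) (ℓ : ℕ) (K : List Bool) :
    (D.entranceNameℓ P ℓ K).length = D.Nℓ ℓ := by
  unfold MasterData.entranceNameℓ; exact length_vname _ _ _ _ _ _

/-- `|name_K(EXIT)| = N ℓ` at master parameter `ℓ`. [folklore] -/
theorem length_exitNameℓ (D : MasterData) (P : PuncturablePRFScheme) (ℓ : ℕ) (K : List Bool) :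
    (D.exitNameℓ P ℓ K).length = D.Nℓ ℓ := by
  unfold MasterData.exitNameℓ; exact length_vname _ _ _ _ _ _

/-- Evaluation of the bounding polynomial `2 q₀(2X) + 2 q₁(2X) + 3 p + 4` of clause (5):
`2 q₀(n + n) + 2 q₁(n + n) + 3 p(n) + 4`. [folklore] -/
theorem eval_lenPoly (q₀ q₁ p : Polynomial ℕ) (n : ℕ) :
    (C 2 * q₀.comp (X + X) + C 2 * q₁.comp (X + X) + C 3 * p + C 4 : Polynomial ℕ).eval n =
      2 * q₀.eval (n + n) + 2 * q₁.eval (n + n) + 3 * p.eval n + 4 := by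
  simp only [eval_add, eval_mul, eval_C, eval_comp, eval_X]

end GenAdm

open GenAdm in
/-- **Stub `stub_admissible`** (registered signature).  The seven clauses of `LineData.Admissible` for the
line datum `D.lineData Γ₁ P` from `GenAdmissible D O P` and `RefAdmissible D Γ₁ O`: (1)–(4) verbatim; (5) the
polynomial length bound `2 q₀(2X) + 2 q₁(2X) + 3 p + 4` from `length_boolPair`, `length_vname`,
`ppolyCircuits` membership and monotone polynomial evaluation; (6)–(7) the level-`ℓ` clauses at
`ℓ = |k| / 4 = t |s|`. [folklore] -/
theorem stub_admissible :
    ∀ (D : MasterData) (Γ₁ : D.Presentation) (O : CircuitObfuscator) (P : PuncturablePRFScheme),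
      GenAdmissible D O P → RefAdmissible D Γ₁ O → (D.lineData Γ₁ P).Admissible O := by
  intro D Γ₁ O P hadm href
  obtain ⟨h1, h2, ⟨p, h3⟩, h4, ⟨q₀, h5⟩, h6, -, n₀, h8⟩ := hadm
  obtain ⟨⟨q₁, r1⟩, r2, n₁, r3⟩ := href
  -- the key `s.take (4 t |s|)` has length `4 t |s|` (clause (4)), so the level read off it is `t |s|`
  have hk : ∀ s : List Bool, (s.take (4 * D.t s.length)).length = 4 * D.t s.length := fun s => by
    rw [List.length_take, Nat.min_eq_left (h4 _)]
  have hℓ : ∀ s : List Bool, (s.take (4 * D.t s.length)).length / 4 = D.t s.length := fun s => by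
    rw [hk s]; omega
  refine ⟨h1, h2, ⟨p, h3⟩, h4,
    ⟨C 2 * q₀.comp (X + X) + C 2 * q₁.comp (X + X) + C 3 * p + C 4, fun s => ?_⟩,
    fun s => ?_, ⟨max n₀ n₁, fun s hs => ?_⟩⟩
  · -- (5) the length bound
    dsimp only [MasterData.lineData, genClear, keyed]
    rw [hℓ s, eval_lenPoly, length_boolPair, length_boolPair, length_entranceNameℓ, length_exitNameℓ]
    have harg : D.t s.length + (s.take (4 * D.t s.length)).length ≤ s.length + s.length := by
      have := h4 s.length; have := hk s; omega
    have hm : D.Nℓ (D.t s.length) + D.Nℓ (D.t s.length) +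
        (D.Γ (D.t s.length) (s.take (4 * D.t s.length))).size ≤ D.ς (D.t s.length) :=
      ((mem_ppolyCircuits_iff _ _ _).1 (h6 _ _)).2
    have hp := h3 s.length
    have e₀ : (encodeSizedCircuit ⟨D.Nℓ (D.t s.length) + D.Nℓ (D.t s.length),
        D.Γ (D.t s.length) (s.take (4 * D.t s.length))⟩).length ≤ q₀.eval (s.length + s.length) :=
      (h5 _ _).trans (natPoly_eval_mono q₀ harg)
    have e₁ : (encodeSizedCircuit ⟨D.Nℓ (D.t s.length) + D.Nℓ (D.t s.length),
        Γ₁ (D.t s.length) (s.take (4 * D.t s.length))⟩).length ≤ q₁.eval (s.length + s.length) :=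
      (r1 _ _).trans (natPoly_eval_mono q₁ harg)
    omega
  · -- (6) membership in `ppolyCircuits (ς (t n))`, equal size, equal function
    dsimp only [MasterData.lineData]
    rw [hℓ s]
    exact ⟨h6 _ _, r2 _ _⟩
  · -- (7) the eventual coin discipline, threshold `max n₀ n₁`
    dsimp only [MasterData.lineData]
    rw [hℓ s]
    exact ⟨Nat.le_sub_of_add_le (h8 s.length (le_of_max_le_left hs) _ (hk s)).1,
      Nat.le_sub_of_add_le (r3 s.length (le_of_max_le_right hs) _ (hk s))⟩

end Summit.QuantumAdvantage.QuantumAdvantage.Theorems.WbwObfuscatedGluedTrees.KnowledgeOfWalk.Generator
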